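import Literature.MathematicalPhysics.QuantumFieldTheory.Balaban1983to89.B7Prop3GeneralLinearBound

/-!
# Bałaban's renormalization group for 4-d lattice Yang–Mills — B7 Proposition 3 AT A GENERAL BACKGROUND `V₀`, the LINEAR
PART, file 5: THE BOUND (126) FROM THE PLAQUETTE DEVIATION `pdev V₀ < β` — the Prop.-4 binder `h3lin` discharged
(`B7Prop3GeneralLinearPdev`)

CITATION HEADER (lean-in-tree rule 2026-08-18).  Audit cell `pub-balaban`, sub-cell `t4` (NE7c ROUND-2 crew, seat
`b2b-balaban-t4-ne7c-formalise-leaf-05` gen 6; owner table `t4/b2b-balaban-t4-ne7c-p1/LEAVES-NE7c-P1.md` v2.6 row S55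
«[B7] PROPOSITION 3 AT A GENERAL REGULAR BACKGROUND», linear part; files 1–4b of the row: `B7Prop3GeneralRotated` p219571,
`B7Prop3GeneralLinear` p219821, `B7Prop3GeneralTild` p220065, `B7Prop3GeneralLinearSplit` p220309, `B7Prop3GeneralLinearBound`
p220545).  SOURCE: [Balaban1985Averaging] = T. Bałaban, «Averaging operations for lattice gauge theories», Comm. Math. Phys.
98 (1985) 17–51, Proposition 3 p. 36, estimate (126) «|(Q(V₀)A)_c| ≦ |A| + O(1)L²α₀|A|», under the plaquette regularity
(44)∕(109) «|V₀(∂p) − 1| < α₀» (pp. 24, 34).  WHAT THIS FILE DOES: restates file 4b's `norm_linQcov_le_of_plaquettes` with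
the regularity hypothesis in the form the k-fold induction of Proposition 4 consumes — the plaquette deviation
`B7Prop2Explicit.pdev V₀ < β ≤ 1∕(1024(d+1)(d+4)L²)` of a background with values in a subgroup `G ≤ {|u| ≤ 1, |u⁻¹| ≤ 1}` —
i.e. EXACTLY the binder `h3lin` of `B7Prop4GeneralLevels.prop4_general_of_prop3` (row S56), with its constants instantiated:
`βmax := 1∕(1024(d+1)(d+4)L²)` (the value used by the (123)∕additivity discharges of the analytic half) and
`c := 800(d+1)²(d+4)` (leading coefficient EXACTLY `L`).  Nothing is re-derived: (126) is file 4b's theorem, the passage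
plaquettes → block loops is b07's `B7Prop2Explicit.norm_Wcx_sub_one_le` inside it, `le_pdev` converts the supremum.
HONEST FRAMING: a junction lemma between two literature reproductions; NOT summit progress (NE7c NOT PROVED; spine PROVED
0∕9; nothing about the continuum limit, infinite volume or the mass gap is claimed).
-/

noncomputable section

open scoped BigOperators
open NormedSpace

namespace Literature.MathematicalPhysics.QuantumFieldTheory.Balaban1983to89.B7Prop3GeneralLinearPdev

open B7Prop1Explicit B7Prop2Explicit B7Eq92Concrete B7Prop3GeneralLinear B7Prop3GeneralLinearBound

-- `Site` alone would resolve to the torus sites of `Setup.lean`; re-export the `ℤ^d` sites of `B7Prop1Explicit`.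
export B7Prop1Explicit (Site)

variable {d : ℕ}

variable {𝔸 : Type*} [NormedRing 𝔸] [NormedAlgebra ℂ 𝔸] [NormOneClass 𝔸] [CompleteSpace 𝔸]

/-- **(126) FROM THE PLAQUETTE DEVIATION**: for a background `V₀` with values in `{|u| ≤ 1, |u⁻¹| ≤ 1}` and
`pdev V₀ ≤ β ≤ 1∕(1024(d+1)(d+4)L²)`, and a field with `sup_b‖A_b‖ ≤ a`, at every `L`-bond `c = (q, κ)`:
`‖L(Q(V₀)A)_c‖ ≤ L·(1 + 800(d+1)²(d+4)·L²β)·a` — print's «|(Q(V₀)A)_c| ≦ (1 + O(1)L²α₀)|A|» with the `O(1)` explicit and the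
factor `L` of the un-normalised linear form `L(Q(V₀)A)_c` of (122) displayed (file 4b's `norm_linQcov_le_of_plaquettes`; the two
smallness conditions there, `512(d+1)(d+4)L²β ≤ 1` and `16(d+1)(d+4)L²β ≤ 1∕8`, follow from `1024(d+1)(d+4)L²β ≤ 1`).
[cite: Balaban1985Averaging, (126) p.36, (44) p.24, (109) p.34] -/
theorem norm_linQcov_le_of_pdev {L : ℕ} (hL : 1 ≤ L) {V₀ : Site d → Fin d → 𝔸ˣ} (hV₀ : ∀ x κ, V₀ x κ ∈ U1 𝔸)
    {β : ℝ} (hβ0 : 0 ≤ β) (hβ : pdev V₀ ≤ β)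
    (hβmax : β ≤ 1 / (1024 * ((d : ℝ) + 1) * ((d : ℝ) + 4) * (L : ℝ) ^ 2))
    {A : Site d → Fin d → 𝔸} {a : ℝ} (ha : 0 ≤ a) (hA : ∀ x κ, ‖A x κ‖ ≤ a) (q : Site d) (κ : Fin d) :
    ‖linQcov L V₀ A q κ‖ ≤ L * (1 + 800 * ((d : ℝ) + 1) ^ 2 * ((d : ℝ) + 4) * (L : ℝ) ^ 2 * β) * a := by
  have hX : (0 : ℝ) < 1024 * ((d : ℝ) + 1) * ((d : ℝ) + 4) * (L : ℝ) ^ 2 := by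
    have hL0 : (0 : ℝ) < L := by exact_mod_cast hL
    positivity
  have hXβ : 1024 * ((d : ℝ) + 1) * ((d : ℝ) + 4) * (L : ℝ) ^ 2 * β ≤ 1 := by
    have := mul_le_mul_of_nonneg_left hβmax hX.le
    rwa [one_div, mul_inv_cancel₀ hX.ne'] at this
  have h44 : ∀ (x : Site d) (κ κ' : Fin d), κ ≠ κ' → ‖((hol V₀ x (plaqWord κ κ') : 𝔸ˣ) : 𝔸) - 1‖ ≤ β :=
    fun x κ κ' _ => (le_pdev hV₀ x κ κ').trans hβ
  have hDL : (0 : ℝ) ≤ ((d : ℝ) + 1) * ((d : ℝ) + 4) * (L : ℝ) ^ 2 * β := by positivity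
  have h := norm_linQcov_le_of_plaquettes L hV₀ ha hA hL q κ hβ0 (by nlinarith) (by nlinarith) h44
  refine h.trans (le_of_eq ?_)
  ring

/-- **THE BINDER `h3lin` OF `B7Prop4GeneralLevels.prop4_general_of_prop3` DISCHARGED** with `βmax := 1∕(1024(d+1)(d+4)L²)` and
`c := 800(d+1)²(d+4)`: for every background `V₀` with values in a subgroup `G ≤ {|u| ≤ 1, |u⁻¹| ≤ 1}` and plaquette deviation
`pdev V₀ < β ≤ βmax`, every field with `sup_b‖A_b‖ ≤ a`, and every `L`-bond, `‖L(Q(V₀)A)_c‖ ≤ L·(1 + c·L²β)·a` — (126) with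
leading coefficient EXACTLY `L` (the shape the k-uniform induction (130)–(133) multiplies up level by level).
[cite: Balaban1985Averaging, (126) p.36, (131)–(133) p.38] -/
theorem h3lin_discharge {L : ℕ} (hL : 1 ≤ L) {G : Subgroup 𝔸ˣ} (hG : G ≤ U1 𝔸) :
    ∀ (V₀ : Site d → Fin d → 𝔸ˣ) (β : ℝ), (∀ x κ, V₀ x κ ∈ G) → 0 ≤ β → pdev V₀ < β →
      β ≤ 1 / (1024 * ((d : ℝ) + 1) * ((d : ℝ) + 4) * (L : ℝ) ^ 2) →
      ∀ (A : Site d → Fin d → 𝔸) (a : ℝ), 0 ≤ a → (∀ x κ, ‖A x κ‖ ≤ a) →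
      ∀ q κ, ‖linQcov L V₀ A q κ‖
        ≤ L * (1 + (800 * ((d : ℝ) + 1) ^ 2 * ((d : ℝ) + 4)) * (L : ℝ) ^ 2 * β) * a :=
  fun V₀ _β hVG hβ0 hβ hβmax _A _a ha hA q κ =>
    (norm_linQcov_le_of_pdev hL (fun x κ' => hG (hVG x κ')) hβ0 hβ.le hβmax ha hA q κ).trans (le_of_eq (by ring))

/-- The same for an averaging-closed structure group (`B7Prop2Explicit.AvgClosed`, whose first field is `G ≤ U1`) — the
hypothesis `hG` of `prop4_general_of_prop3` itself. [cite: Balaban1985Averaging, (126) p.36, (131)–(133) p.38] -/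
theorem h3lin_discharge_of_avgClosed {L : ℕ} (hL : 1 ≤ L) {G : Subgroup 𝔸ˣ} (hG : AvgClosed d L G) :
    ∀ (V₀ : Site d → Fin d → 𝔸ˣ) (β : ℝ), (∀ x κ, V₀ x κ ∈ G) → 0 ≤ β → pdev V₀ < β →
      β ≤ 1 / (1024 * ((d : ℝ) + 1) * ((d : ℝ) + 4) * (L : ℝ) ^ 2) →
      ∀ (A : Site d → Fin d → 𝔸) (a : ℝ), 0 ≤ a → (∀ x κ, ‖A x κ‖ ≤ a) →
      ∀ q κ, ‖linQcov L V₀ A q κ‖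
        ≤ L * (1 + (800 * ((d : ℝ) + 1) ^ 2 * ((d : ℝ) + 4)) * (L : ℝ) ^ 2 * β) * a :=
  h3lin_discharge hL hG.le_U1

end Literature.MathematicalPhysics.QuantumFieldTheory.Balaban1983to89.B7Prop3GeneralLinearPdev

end
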